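import Summits.QuantumFields.YangMills.Theorems.UnitScaleGibbsBlockPlaquetteTransportFreeLinearisationLocal
import Summits.QuantumFields.YangMills.Theorems.UnitScaleGibbsBlockPlaquetteSmallFieldBoxBridge
import HarnessLib

/-!
# `UnitScaleGibbsBlockPlaquetteLinearisationOnBoxEvent` — THE LOCAL LINEARISATION CHAIN OF A BLOCK PLAQUETTE, PACKAGED: ON THE LEVEL-0 SMALL-FIELD
# EVENT OF ONE BOX, `‖V̄^{j}(∂a) − 1 − Σ_p linWeight j a p • (V(∂p) − 1)‖ ≤ C₁·D^{j}·((1+(d−1)n)θ)²` FOR THE AXIAL-GAUGE REPRESENTATIVE `V`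
# (explicit cone, radii, budgets; crux `UnitScaleTilt.HistoryTailL`, stmt-QuantumFields-19936; bears on LINE 28's `stub_linTest`, stmt-QuantumFields-23083)

Cell `ym3-torus` (YM ladder rung R3 = continuum SU(2) Yang–Mills on T³ — a RUNG, NOT the Clay problem: not d = 4, not infinite volume, not a
mass gap), width seat `ym-ust-19936-w2` (gen 15).  The gen-14 chain ✓`UnitScaleGibbsBlockPlaquetteSmallFieldBoxBridge.hull_small_of_plaqSmallOn_box` (D)
⟹ ✓`UnitScaleGibbsBlockPlaquetteSmallFieldCone.smallFieldCone ∕ smallFieldCone_transporter` (C) ⟹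
✓`UnitScaleGibbsBlockPlaquetteTransportFreeLinearisationLocal.norm_iter_plaqHol_sub_one_sub_linProxy_le_loc` (B) takes as DATA a cone of walk hulls
`(c i, R i)`, four budget sequences `a, η, τ, ρ : ℕ → ℝ` and nine recursion∕window hypotheses.  THIS FILE discharges all of them:
* §1 the BUDGETS in closed form — `a i = η i = M^i·Θ`, `τ i = (d+4)L·M^i·Θ`, `ρ i = C₁·D^i·Θ²` with the absolute (given `d, L`) constants
  `M = L² + 143·(((d+4)L)²∕4)² + 6·((d+2)L)²∕4 + L`, `C₁ = 143·(((d+4)L)²∕4)² + L⁴ + 2(d+4)L³`, `D = M² + L² + 2(d+4)L³` — satisfy the three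
  recursions of (B)∕(C) as soon as `M^j·Θ ≤ 1` (`budget_step_a`, `budget_step_eta`, `budget_step_rho`);
* §2 the CONE — for every site `x` of `T^{(j)}` a family `c i : Site P i` with `c j = x`, `c i = emb (c (i+1))` (`exists_cone`), and the radii
  `R i = ((d+4)L+2)·Σ_{k<j−i} L^k` with `L·R(i+1) + (d+4)L + 2 = R i` (`radius_step`), `R j = 0`, `R 0 ≤ ((d+4)L+2)·L^j` (`radius_zero_le`);
* §3 ★★★ `norm_iter_plaqHol_sub_one_sub_linProxy_le_of_plaqSmallOn_box` — THE PACKAGED THEOREM: for a non-wrapping box `[lo, hi]` (`hi ≤ lo + n`,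
  `n < sitesPerDir 0`) whose interior contains the base hull (`lo + R 0 ≤ z₀ ≤ hi − R 0 − 2`, `c 0 = castSite z₀`), on `PlaqSmallOn (boxPlaqs lo hi) θ U`
  with `0 ≤ θ`, `Θ = (1 + (d−1)n)·θ`, `M^j·Θ ≤ 1` and `(((d+4)L)²∕4)·M^j·Θ ≤ δ_N∕2`, the axial-gauge representative `V = U^{axialGauge U lo hi}` satisfies
  `‖(V̄^{j}(∂a) : M_N) − 1 − Σ_p linWeight j a p • ((V(∂p) : M_N) − 1)‖ ≤ C₁·D^{j}·Θ²` for the plaquette `a = ⟨c j; μ < ν⟩`;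
* §4 ★★ `exists_box_linearisation` — for every level-`j` plaquette `a` with `2·R 0 + 2 < sitesPerDir 0` there IS such a box, of side `n = 2·R 0 + 2`
  (`≤ (2(d+4)L+4)·L^j + 2`), around the iterated block centre of `a` (✓`exists_box_around`), for which the display holds for every `U` and `θ`.
The second-order size `Θ² = O(n²θ²)` with a `poly(L)^j` constant is the «`O(θ²·poly(L^j))` absorbed by the window» of LINE 28's card; the
statement is MECHANISM-AGNOSTIC (it is the deterministic half of any line that linearises a block plaquette on a box event; it does not involve the
Schwinger–Dyson observables, whose identification with the linear proxy is obstructed — bus 2026-08-29 NET-FLUX∕WITNESS).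

HONEST FRAMING.  Deterministic lattice bookkeeping (real arithmetic of three recursions + the cone geometry) over the tree's own objects;
`--supports stmt-QuantumFields-19936 --as helper`; proves no stub, crux, rung or summit statement; `stub_linTest`, «ShallowFluxSecondMomentL», (Q),
K1, `MeanDeviationL`, `HistoryTailL` are NOT proved; the Yang–Mills mass gap is NOT proved.

References: [Balaban1985Averaging] T. Bałaban, CMP 98 (1985) 17–51, Prop. 1 (51) pp. 25–26 and (124) p. 36; [Balaban1987RG1] T. Bałaban, CMP 109
(1987) 249–301, (0.1)–(0.4), (0.11) pp. 251–253; [Balaban1985UV3] T. Bałaban, CMP 102 (1985) 255–275, (38)–(40) p. 266.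
-/

noncomputable section

set_option autoImplicit false

open scoped BigOperators

namespace Summit.QuantumFields.YangMills.Theorems.UnitScaleGibbsBlockPlaquetteLinearisationOnBoxEvent

open Literature.MathematicalPhysics.QuantumFieldTheory.Balaban1983to89
open Literature.MathematicalPhysics.QuantumFieldTheory.Balaban1983to89.B10Eq47AxialChi (shiftN rowProd)
open Literature.MathematicalPhysics.QuantumFieldTheory.Balaban1983to89.BlockAveraging (avgFun off blockAvg)
open Literature.MathematicalPhysics.QuantumFieldTheory.Balaban1983to89.ExpMeanLog (expMeanLogSU deltaSU deltaSU_pos)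
open Literature.MathematicalPhysics.QuantumFieldTheory.Balaban1983to89.T4AxialGaugeSmallField (castSite castSite_apply boxPlaqs axialGauge)
open T4Continuum (holAt walk walkEnd stairWord Letter)
open Summit.QuantumFields.YangMills.Theorems.UnitScaleGibbsBlockPlaquetteLinWeight
open Summit.QuantumFields.YangMills.Theorems.UnitScaleGibbsBlockPlaquetteTransportFreeLinearisationLocal (norm_iter_plaqHol_sub_one_sub_linProxy_le_loc)
open Summit.QuantumFields.YangMills.Theorems.UnitScaleGibbsBlockPlaquetteSmallFieldCone (smallFieldCone smallFieldCone_transporter)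
open Summit.QuantumFields.YangMills.Theorems.UnitScaleGibbsBlockPlaquetteSmallFieldBoxBridge (hull_small_of_plaqSmallOn_box exists_box_around)

variable {P : Params}

/-! ## §1 The budgets in closed form -/

section Budgets

variable (d L : ℕ)

/-- `budget_step_a`: with `s(a) = (((d+4)L)²∕4)·a`, the one-step plaquette growth `L²·a + 143·s(a)² ≤ M·a` for `0 ≤ a ≤ 1`, where
`M = L² + 143·(((d+4)L)²∕4)² + 6·((d+2)L)²∕4 + L`. [cite: Balaban1985Averaging, Prop. 1 (51) pp.25-26] -/
theorem budget_step_a {a : ℝ} (ha0 : 0 ≤ a) (ha1 : a ≤ 1) :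
    (L : ℝ) ^ 2 * a + 143 * (((((d + 4) * L : ℕ) : ℝ) ^ 2 / 4) * a) ^ 2 ≤
      ((L : ℝ) ^ 2 + 143 * ((((d + 4) * L : ℕ) : ℝ) ^ 2 / 4) ^ 2 + 6 * ((((d + 2) * L : ℕ) : ℝ) ^ 2 / 4) + L) * a := by
  have h1 : a ^ 2 ≤ a := by nlinarith
  have h2 : (0 : ℝ) ≤ 143 * ((((d + 4) * L : ℕ) : ℝ) ^ 2 / 4) ^ 2 := by positivity
  have h3 : (0 : ℝ) ≤ (6 * ((((d + 2) * L : ℕ) : ℝ) ^ 2 / 4) + L) * a := by positivity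
  nlinarith [mul_le_mul_of_nonneg_left h1 h2]

/-- `budget_step_eta`: the one-step bond growth `6·(((d+2)L)²∕4)·a + L·η ≤ M·X` when `a, η ≤ X`, `0 ≤ X`. [cite: Balaban1985Averaging, (124) p.36] -/
theorem budget_step_eta {a η X : ℝ} (ha0 : 0 ≤ a) (haX : a ≤ X) (_hη0 : 0 ≤ η) (hηX : η ≤ X) :
    6 * (((((d + 2) * L : ℕ) : ℝ) ^ 2 / 4) * a) + (L : ℝ) * η ≤
      ((L : ℝ) ^ 2 + 143 * ((((d + 4) * L : ℕ) : ℝ) ^ 2 / 4) ^ 2 + 6 * ((((d + 2) * L : ℕ) : ℝ) ^ 2 / 4) + L) * X := by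
  have hX : 0 ≤ X := ha0.trans haX
  have h1 : 6 * (((((d + 2) * L : ℕ) : ℝ) ^ 2 / 4) * a) ≤ 6 * ((((d + 2) * L : ℕ) : ℝ) ^ 2 / 4) * X := by
    rw [← mul_assoc]; exact mul_le_mul_of_nonneg_left haX (by positivity)
  have h2 : (L : ℝ) * η ≤ (L : ℝ) * X := mul_le_mul_of_nonneg_left hηX (Nat.cast_nonneg L)
  have h3 : (0 : ℝ) ≤ ((L : ℝ) ^ 2 + 143 * ((((d + 4) * L : ℕ) : ℝ) ^ 2 / 4) ^ 2) * X := by positivity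
  nlinarith

/-- `budget_step_rho`: the one-step remainder growth: with `X ≤ 1` bounding the plaquette and bond sizes of level `i` and `ρ` the level-`i` remainder,
`143·s(X)² + (L²X)² + L²ρ + L²·(2·((d+4)L·X)·(X + ρ)) ≤ C₁·X² + (L² + 2(d+4)L³)·ρ`, `C₁ = 143·(((d+4)L)²∕4)² + L⁴ + 2(d+4)L³`.
[cite: Balaban1985Averaging, Prop. 1 (51) pp.25-26] -/
theorem budget_step_rho {X ρ : ℝ} (_hX0 : 0 ≤ X) (hX1 : X ≤ 1) (hρ : 0 ≤ ρ) :
    143 * (((((d + 4) * L : ℕ) : ℝ) ^ 2 / 4) * X) ^ 2 + (((L * L : ℕ) : ℝ) * X) ^ 2 + ((L * L : ℕ) : ℝ) * ρ +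
        ((L * L : ℕ) : ℝ) * (2 * ((((d + 4) * L : ℕ) : ℝ) * X) * (X + ρ)) ≤
      (143 * ((((d + 4) * L : ℕ) : ℝ) ^ 2 / 4) ^ 2 + (L : ℝ) ^ 4 + 2 * (((d + 4) * L : ℕ) : ℝ) * (L : ℝ) ^ 2) * X ^ 2 +
        ((L : ℝ) ^ 2 + 2 * (((d + 4) * L : ℕ) : ℝ) * (L : ℝ) ^ 2) * ρ := by
  have hLL : ((L * L : ℕ) : ℝ) = (L : ℝ) ^ 2 := by push_cast; ring
  rw [hLL]
  have h1 : X * ρ ≤ ρ := by nlinarith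
  have h2 : (0 : ℝ) ≤ 2 * (((d + 4) * L : ℕ) : ℝ) * (L : ℝ) ^ 2 := by positivity
  nlinarith [mul_le_mul_of_nonneg_left h1 h2, sq_nonneg X]

end Budgets

/-! ## §2 The cone of iterated block centres and its radii -/

section Cone

/-- ★ For every site `x` of `T^{(j)}` there is a family of centres `c i : Site P i`, `i ∈ ℕ`, with `c j = x` and `c i = emb (c (i+1))` for `i < j`
(the iterated block centres `emb^{j−i} x` below `x`). [cite: Balaban1987RG1, (0.1) p.252] -/
theorem exists_cone : ∀ (j : ℕ) (x : Site P j), ∃ c : (i : ℕ) → Site P i, c j = x ∧ ∀ i, i < j → c i = emb (c (i + 1))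
  | 0, x => ⟨fun i => match i with
      | 0 => x
      | _ + 1 => default, rfl, fun i hi => absurd hi (Nat.not_lt_zero i)⟩
  | j + 1, x => by
    obtain ⟨c', hc'j, hc'⟩ := exists_cone j (emb x)
    refine ⟨fun i => if h : i = j + 1 then h ▸ x else c' i, by simp, fun i hi => ?_⟩
    have hne : i ≠ j + 1 := Nat.ne_of_lt hi
    by_cases hij : i = j
    · subst hij
      simp [hc'j]
    · have hlt : i < j := lt_of_le_of_ne (Nat.le_of_lt_succ hi) hij
      have hne' : i + 1 ≠ j + 1 := by omega
      simp only [dif_neg hne, dif_neg hne']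
      exact hc' i hlt

/-- The radii `R i = ((d+4)L+2)·Σ_{k<j−i} L^k` satisfy the cone recursion with EQUALITY: `L·R(i+1) + ((d+4)L+2) = R i` for `i < j`.
[cite: Balaban1987RG1, (0.11) p.253] -/
theorem radius_step (j i : ℕ) (hi : i < j) :
    P.L * (((P.d + 4) * P.L + 2) * ∑ k ∈ Finset.range (j - (i + 1)), P.L ^ k) + ((P.d + 4) * P.L + 2) =
      ((P.d + 4) * P.L + 2) * ∑ k ∈ Finset.range (j - i), P.L ^ k := by
  have hji : j - i = (j - (i + 1)) + 1 := by omega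
  rw [hji, Finset.sum_range_succ', pow_zero, mul_add, mul_one, Finset.mul_sum, Finset.mul_sum, Finset.mul_sum]
  congr 1
  refine Finset.sum_congr rfl fun k _ => ?_
  rw [pow_succ]
  ring

/-- `R j = 0`: the top of the cone is the target site itself. [cite: Balaban1987RG1, (0.11) p.253] -/
theorem radius_top (j : ℕ) : ((P.d + 4) * P.L + 2) * ∑ k ∈ Finset.range (j - j), P.L ^ k = 0 := by
  simp

/-- `Σ_{k<j} L^k ≤ L^j` for `1 < L` (geometric sum). [folklore] -/
theorem sum_pow_lt_le (j : ℕ) : ∑ k ∈ Finset.range j, P.L ^ k ≤ P.L ^ j := by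
  have hL : 2 ≤ P.L := P.hL.2
  induction j with
  | zero => simp
  | succ j ih =>
    rw [Finset.sum_range_succ, pow_succ]
    have : P.L ^ j * 2 ≤ P.L ^ j * P.L := Nat.mul_le_mul_left _ hL
    omega

/-- `R 0 ≤ ((d+4)L+2)·L^j`: the base radius is `O(L^j)`. [cite: Balaban1987RG1, (0.11) p.253] -/
theorem radius_zero_le (j : ℕ) :
    ((P.d + 4) * P.L + 2) * ∑ k ∈ Finset.range (j - 0), P.L ^ k ≤ ((P.d + 4) * P.L + 2) * P.L ^ j := by
  rw [Nat.sub_zero]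
  exact Nat.mul_le_mul_left _ (sum_pow_lt_le j)

end Cone

/-! ## §3 The glue: box event + a cone inside the box + abstract budget constants ⟹ the j-fold linearisation -/

section Main

open scoped Matrix.Norms.L2Operator

variable {n : Type*} [Fintype n] [DecidableEq n] [Nonempty n]

/-- ★★ **THE GLUE (abstract budget constants).**  Box event (D) ⟹ cone feeds (C) ⟹ `j`-fold linearisation (B), for ANY constants `M ≥ 1`, `C₁, C₂ ≥ 0`
validating the three one-step budget inequalities (`hA` plaquettes, `hB` bonds, `hC` remainder) and any `Θ` dominating the level-0 plaquette size `θ`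
and bond size `(d−1)n₀θ` of the axial-gauge representative, in the window `M^j·Θ ≤ 1`, `(((d+4)L)²∕4)·M^j·Θ ≤ δ_N∕2`: the remainder is
`C₁·(M² + C₂)^j·Θ²`.  (Budgets `a i = η i = M^iΘ`, `τ i = (d+4)L·M^iΘ`, `ρ i = C₁(M²+C₂)^iΘ²`; radii `R i = ((d+4)L+2)·Σ_{k<j−i}L^k`.)
[cite: Balaban1985Averaging, Prop. 1 (51) pp.25-26 and (124) p.36; Balaban1987RG1, (0.1)-(0.4) and (0.11) pp.251-253; Balaban1985UV3, (38)-(40) p.266] -/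
theorem norm_iter_plaqHol_sub_one_sub_linProxy_le_of_box_of_budgets
    (U : GaugeField P 0 (Matrix.specialUnitaryGroup n ℂ)) {lo hi : Fin P.d → ℤ} {n₀ : ℕ}
    (hn : ∀ κ, hi κ ≤ lo κ + n₀) (hnN : n₀ < P.sitesPerDir 0) {θ : ℝ} (hθ : 0 ≤ θ)
    (hU : PlaqSmallOn (boxPlaqs lo hi) θ U) {j : ℕ} (c : (i : ℕ) → Site P i)
    (hc : ∀ i, i < j → c i = emb (c (i + 1))) (z₀ : Fin P.d → ℤ) (hz : c 0 = castSite z₀)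
    (hlo : ∀ κ, lo κ + (((P.d + 4) * P.L + 2) * ∑ k ∈ Finset.range j, P.L ^ k : ℕ) ≤ z₀ κ)
    (hhi : ∀ κ, z₀ κ + (((P.d + 4) * P.L + 2) * ∑ k ∈ Finset.range j, P.L ^ k : ℕ) + 2 ≤ hi κ)
    {Θ M C₁ C₂ : ℝ} (hθΘ : θ ≤ Θ) (hηΘ : ((P.d - 1 : ℕ) : ℝ) * n₀ * θ ≤ Θ) (hM1 : 1 ≤ M) (hC₁ : 0 ≤ C₁) (hC₂ : 0 ≤ C₂)
    (hA : ∀ x : ℝ, 0 ≤ x → x ≤ 1 → (P.L : ℝ) ^ 2 * x + 143 * (((((P.d + 4) * P.L : ℕ) : ℝ) ^ 2 / 4) * x) ^ 2 ≤ M * x)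
    (hB : ∀ x : ℝ, 0 ≤ x → 6 * (((((P.d + 2) * P.L : ℕ) : ℝ) ^ 2 / 4) * x) + (P.L : ℝ) * x ≤ M * x)
    (hC : ∀ x r : ℝ, 0 ≤ x → x ≤ 1 → 0 ≤ r →
      143 * (((((P.d + 4) * P.L : ℕ) : ℝ) ^ 2 / 4) * x) ^ 2 + (((P.L * P.L : ℕ) : ℝ) * x) ^ 2 + ((P.L * P.L : ℕ) : ℝ) * r +
          ((P.L * P.L : ℕ) : ℝ) * (2 * ((((P.d + 4) * P.L : ℕ) : ℝ) * x) * (x + r)) ≤ C₁ * x ^ 2 + C₂ * r)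
    (hwin : M ^ j * Θ ≤ 1) (hwinδ : ((((P.d + 4) * P.L : ℕ) : ℝ) ^ 2 / 4) * (M ^ j * Θ) ≤ deltaSU n / 2)
    (μ ν : Fin P.d) (hμν : μ < ν) :
    ‖(((GaugeField.plaqHol (Averaging.iter (fun i' => blockAvg (P := P) (j := i') (expMeanLogSU (n := n))) j
            (GaugeField.gaugeAct (axialGauge U lo hi) U)) ⟨c j, μ, ν, hμν⟩ : Matrix.specialUnitaryGroup n ℂ) : Matrix n n ℂ) - 1) -
        ∑ p : Plaq P 0, ((linWeight j ⟨c j, μ, ν, hμν⟩ p : ℝ) : ℂ) •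
          ((((GaugeField.plaqHol (GaugeField.gaugeAct (axialGauge U lo hi) U) p : Matrix.specialUnitaryGroup n ℂ)) : Matrix n n ℂ) - 1)‖ ≤
      C₁ * (M ^ 2 + C₂) ^ j * Θ ^ 2 := by
  have hM0 : 0 ≤ M := zero_le_one.trans hM1
  have hΘ0 : 0 ≤ Θ := hθ.trans hθΘ
  -- the budgets and radii (definitions local to this proof)
  let a : ℕ → ℝ := fun i => M ^ i * Θ
  let τ : ℕ → ℝ := fun i => (((P.d + 4) * P.L : ℕ) : ℝ) * a i
  let ρ : ℕ → ℝ := fun i => C₁ * (M ^ 2 + C₂) ^ i * Θ ^ 2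
  let R : ℕ → ℕ := fun i => ((P.d + 4) * P.L + 2) * ∑ k ∈ Finset.range (j - i), P.L ^ k
  have ha0 : ∀ i, 0 ≤ a i := fun i => mul_nonneg (pow_nonneg hM0 i) hΘ0
  have hmono : ∀ i, i ≤ j → a i ≤ M ^ j * Θ := fun i hij =>
    mul_le_mul_of_nonneg_right (pow_le_pow_right₀ hM1 hij) hΘ0
  have ha1 : ∀ i, i ≤ j → a i ≤ 1 := fun i hij => (hmono i hij).trans hwin
  have hasucc : ∀ i, a (i + 1) = M * a i := fun i => by
    show M ^ (i + 1) * Θ = M * (M ^ i * Θ)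
    rw [pow_succ]; ring
  have hρnn : ∀ i, 0 ≤ ρ i := fun i => mul_nonneg (mul_nonneg hC₁ (pow_nonneg (by positivity) i)) (sq_nonneg Θ)
  -- level-0 inputs from the box (D)
  have hR0 : R 0 = ((P.d + 4) * P.L + 2) * ∑ k ∈ Finset.range j, P.L ^ k := by
    show ((P.d + 4) * P.L + 2) * ∑ k ∈ Finset.range (j - 0), P.L ^ k = _
    rw [Nat.sub_zero]
  obtain ⟨hplaq0, hbond0⟩ := hull_small_of_plaqSmallOn_box U hn hnN hθ hU z₀ (R := R 0)
    (fun κ => by rw [hR0]; exact hlo κ) (fun κ => by rw [hR0]; exact hhi κ)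
  have ha00 : a 0 = Θ := by show M ^ 0 * Θ = Θ; rw [pow_zero, one_mul]
  have hplaq0' : ∀ v : List (Letter P.d), v.length ≤ R 0 → ∀ (a' b : Fin P.d) (h : a' < b),
      dist1 (GaugeField.plaqHol (GaugeField.gaugeAct (axialGauge U lo hi) U) ⟨walkEnd (c 0) v, a', b, h⟩) ≤ a 0 :=
    fun v hv a' b h => by rw [hz, ha00]; exact (hplaq0 v hv a' b h).trans hθΘ
  have hbond0' : ∀ v : List (Letter P.d), v.length ≤ R 0 → ∀ κ : Fin P.d,
      dist1 (GaugeField.gaugeAct (axialGauge U lo hi) U ⟨walkEnd (c 0) v, κ⟩) ≤ a 0 :=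
    fun v hv κ => by rw [hz, ha00]; exact (hbond0 v hv κ).trans hηΘ
  -- the cone radii
  have hRstep : ∀ i, i < j → P.L * R (i + 1) + ((P.d + 4) * P.L + 2) ≤ R i := fun i hij => (radius_step j i hij).le
  -- the recursion hypotheses of (C) and (B)
  have hs : ∀ i, i < j → ((((P.d + 4) * P.L : ℕ) : ℝ) ^ 2 / 4) * a i ≤ deltaSU n / 2 := fun i hij =>
    (mul_le_mul_of_nonneg_left (hmono i hij.le) (by positivity)).trans hwinδ
  have hstepa : ∀ i, i < j → (P.L : ℝ) ^ 2 * a i + 143 * (((((P.d + 4) * P.L : ℕ) : ℝ) ^ 2 / 4) * a i) ^ 2 ≤ a (i + 1) :=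
    fun i hij => by rw [hasucc]; exact hA (a i) (ha0 i) (ha1 i hij.le)
  have hstepη : ∀ i, i < j → 6 * (((((P.d + 2) * P.L : ℕ) : ℝ) ^ 2 / 4) * a i) + (P.L : ℝ) * a i ≤ a (i + 1) :=
    fun i hij => by rw [hasucc]; exact hB (a i) (ha0 i)
  have hstep : ∀ i, i < j → 143 * (((((P.d + 4) * P.L : ℕ) : ℝ) ^ 2 / 4) * a i) ^ 2 + (((P.L * P.L : ℕ) : ℝ) * a i) ^ 2 +
      ((P.L * P.L : ℕ) : ℝ) * ρ i + ((P.L * P.L : ℕ) : ℝ) * (2 * τ i * (a i + ρ i)) ≤ ρ (i + 1) := fun i hij => by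
    refine (hC (a i) (ρ i) (ha0 i) (ha1 i hij.le) (hρnn i)).trans ?_
    -- `C₁ (M^iΘ)² + C₂ ρ_i ≤ C₁ (M²+C₂)^{i+1} Θ²`
    show C₁ * (M ^ i * Θ) ^ 2 + C₂ * (C₁ * (M ^ 2 + C₂) ^ i * Θ ^ 2) ≤ C₁ * (M ^ 2 + C₂) ^ (i + 1) * Θ ^ 2
    have hMD : (M ^ 2) ^ i ≤ (M ^ 2 + C₂) ^ i := pow_le_pow_left₀ (by positivity) (le_add_of_nonneg_right hC₂) i
    have e1 : C₁ * (M ^ i * Θ) ^ 2 + C₂ * (C₁ * (M ^ 2 + C₂) ^ i * Θ ^ 2) =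
        C₁ * Θ ^ 2 * ((M ^ 2) ^ i + C₂ * (M ^ 2 + C₂) ^ i) := by rw [← pow_mul, mul_comm 2 i, pow_mul]; ring
    have e2 : C₁ * (M ^ 2 + C₂) ^ (i + 1) * Θ ^ 2 = C₁ * Θ ^ 2 * ((M ^ 2 + C₂) ^ i * (M ^ 2 + C₂)) := by rw [pow_succ]; ring
    rw [e1, e2]
    refine mul_le_mul_of_nonneg_left ?_ (mul_nonneg hC₁ (sq_nonneg Θ))
    have hDi : 0 ≤ (M ^ 2 + C₂) ^ i := pow_nonneg (by positivity) i
    nlinarith [mul_le_mul_of_nonneg_left hM1 (mul_nonneg hDi hM0)]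
  -- the feeds (C): plaquette sizes at all levels `i < j`, and the one-step transporters
  have hplaq : ∀ i, i < j → ∀ v : List (Letter P.d), v.length ≤ R i → ∀ (a' b : Fin P.d) (h : a' < b),
      dist1 (GaugeField.plaqHol (Averaging.iter (fun i' => blockAvg (P := P) (j := i') (expMeanLogSU (n := n))) i
        (GaugeField.gaugeAct (axialGauge U lo hi) U)) ⟨walkEnd (c i) v, a', b, h⟩) ≤ a i := fun i hij =>
    (smallFieldCone (GaugeField.gaugeAct (axialGauge U lo hi) U) a a c R i (fun i' hij' => hc i' (hij'.trans hij))
      (fun i' hij' => hRstep i' (hij'.trans hij)) (ha0 0) (ha0 0) hplaq0' hbond0' (fun i' hij' => hs i' (hij'.trans hij))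
      (fun i' hij' => hstepa i' (hij'.trans hij)) (fun i' hij' => hstepη i' (hij'.trans hij))).2.2.1
  have hτ := smallFieldCone_transporter (GaugeField.gaugeAct (axialGauge U lo hi) U) a a c R j hc hRstep (ha0 0) (ha0 0)
    hplaq0' hbond0' hs hstepa hstepη
  -- (B) at the top of the cone, for the empty walk
  have hRj : ([] : List (Letter P.d)).length ≤ R j := by
    show 0 ≤ ((P.d + 4) * P.L + 2) * ∑ k ∈ Finset.range (j - j), P.L ^ k
    exact Nat.zero_le _
  exact norm_iter_plaqHol_sub_one_sub_linProxy_le_loc (GaugeField.gaugeAct (axialGauge U lo hi) U) a τ ρ c R j hc hRstep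
    (fun i _ => ha0 i) hplaq hs hτ (hρnn 0) hstep [] hRj μ ν hμν

/-- ★★★ **THE LOCAL LINEARISATION CHAIN, PACKAGED (explicit constants).**  Let `[lo, hi]` be a non-wrapping integer box of `T^{(0)}` (`hi ≤ lo + n₀`,
`n₀ < sitesPerDir 0`), `U` a level-0 `SU(N)` field with `PlaqSmallOn (boxPlaqs lo hi) θ U`, `0 ≤ θ`, and `V = U^{axialGauge U lo hi}`.  Let
`c i : Site P i` be a cone of centres (`c i = emb (c (i+1))`, `i < j`) whose base centre is `castSite z₀` with the margins `lo + R₀ ≤ z₀ ≤ hi − R₀ − 2`,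
`R₀ = ((d+4)L+2)·Σ_{k<j} L^k`.  With `Θ = (1 + (d−1)n₀)·θ`, `M = L² + 143·(((d+4)L)²∕4)² + 6·((d+2)L)²∕4 + L`, in the window `M^j·Θ ≤ 1`,
`(((d+4)L)²∕4)·M^j·Θ ≤ δ_N∕2`, for the plaquette `a = ⟨c j; μ < ν⟩`:
`‖(V̄^{j}(∂a) : M_N) − 1 − Σ_p linWeight j a p • ((V(∂p) : M_N) − 1)‖ ≤ C₁·(M² + C₂)^j·Θ²`,
`C₁ = 143·(((d+4)L)²∕4)² + L⁴ + 2(d+4)L·L²`, `C₂ = L² + 2(d+4)L·L²` — a `poly(d,L)^j·(n₀θ)²` remainder.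
[cite: Balaban1985Averaging, Prop. 1 (51) pp.25-26 and (124) p.36; Balaban1987RG1, (0.1)-(0.4) and (0.11) pp.251-253; Balaban1985UV3, (38)-(40) p.266] -/
theorem norm_iter_plaqHol_sub_one_sub_linProxy_le_of_plaqSmallOn_box
    (U : GaugeField P 0 (Matrix.specialUnitaryGroup n ℂ)) {lo hi : Fin P.d → ℤ} {n₀ : ℕ}
    (hn : ∀ κ, hi κ ≤ lo κ + n₀) (hnN : n₀ < P.sitesPerDir 0) {θ : ℝ} (hθ : 0 ≤ θ)
    (hU : PlaqSmallOn (boxPlaqs lo hi) θ U) {j : ℕ} (c : (i : ℕ) → Site P i)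
    (hc : ∀ i, i < j → c i = emb (c (i + 1))) (z₀ : Fin P.d → ℤ) (hz : c 0 = castSite z₀)
    (hlo : ∀ κ, lo κ + (((P.d + 4) * P.L + 2) * ∑ k ∈ Finset.range j, P.L ^ k : ℕ) ≤ z₀ κ)
    (hhi : ∀ κ, z₀ κ + (((P.d + 4) * P.L + 2) * ∑ k ∈ Finset.range j, P.L ^ k : ℕ) + 2 ≤ hi κ)
    (hwin : ((P.L : ℝ) ^ 2 + 143 * ((((P.d + 4) * P.L : ℕ) : ℝ) ^ 2 / 4) ^ 2 + 6 * ((((P.d + 2) * P.L : ℕ) : ℝ) ^ 2 / 4) + P.L) ^ j *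
        ((1 + ((P.d - 1 : ℕ) : ℝ) * n₀) * θ) ≤ 1)
    (hwinδ : ((((P.d + 4) * P.L : ℕ) : ℝ) ^ 2 / 4) *
        (((P.L : ℝ) ^ 2 + 143 * ((((P.d + 4) * P.L : ℕ) : ℝ) ^ 2 / 4) ^ 2 + 6 * ((((P.d + 2) * P.L : ℕ) : ℝ) ^ 2 / 4) + P.L) ^ j *
          ((1 + ((P.d - 1 : ℕ) : ℝ) * n₀) * θ)) ≤ deltaSU n / 2)
    (μ ν : Fin P.d) (hμν : μ < ν) :
    ‖(((GaugeField.plaqHol (Averaging.iter (fun i' => blockAvg (P := P) (j := i') (expMeanLogSU (n := n))) j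
            (GaugeField.gaugeAct (axialGauge U lo hi) U)) ⟨c j, μ, ν, hμν⟩ : Matrix.specialUnitaryGroup n ℂ) : Matrix n n ℂ) - 1) -
        ∑ p : Plaq P 0, ((linWeight j ⟨c j, μ, ν, hμν⟩ p : ℝ) : ℂ) •
          ((((GaugeField.plaqHol (GaugeField.gaugeAct (axialGauge U lo hi) U) p : Matrix.specialUnitaryGroup n ℂ)) : Matrix n n ℂ) - 1)‖ ≤
      (143 * ((((P.d + 4) * P.L : ℕ) : ℝ) ^ 2 / 4) ^ 2 + (P.L : ℝ) ^ 4 + 2 * (((P.d + 4) * P.L : ℕ) : ℝ) * (P.L : ℝ) ^ 2) *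
        (((P.L : ℝ) ^ 2 + 143 * ((((P.d + 4) * P.L : ℕ) : ℝ) ^ 2 / 4) ^ 2 + 6 * ((((P.d + 2) * P.L : ℕ) : ℝ) ^ 2 / 4) + P.L) ^ 2 +
            ((P.L : ℝ) ^ 2 + 2 * (((P.d + 4) * P.L : ℕ) : ℝ) * (P.L : ℝ) ^ 2)) ^ j *
          ((1 + ((P.d - 1 : ℕ) : ℝ) * n₀) * θ) ^ 2 := by
  have hL1 : (1 : ℝ) ≤ (P.L : ℝ) := by exact_mod_cast P.hL.2.le
  have hM1 : (1 : ℝ) ≤ (P.L : ℝ) ^ 2 + 143 * ((((P.d + 4) * P.L : ℕ) : ℝ) ^ 2 / 4) ^ 2 +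
      6 * ((((P.d + 2) * P.L : ℕ) : ℝ) ^ 2 / 4) + P.L := by
    have h0 : (0 : ℝ) ≤ 143 * ((((P.d + 4) * P.L : ℕ) : ℝ) ^ 2 / 4) ^ 2 + 6 * ((((P.d + 2) * P.L : ℕ) : ℝ) ^ 2 / 4) + P.L := by
      positivity
    nlinarith
  have hθΘ : θ ≤ (1 + ((P.d - 1 : ℕ) : ℝ) * n₀) * θ := by
    have : (0 : ℝ) ≤ ((P.d - 1 : ℕ) : ℝ) * n₀ * θ := by positivity
    nlinarith
  have hηΘ : ((P.d - 1 : ℕ) : ℝ) * n₀ * θ ≤ (1 + ((P.d - 1 : ℕ) : ℝ) * n₀) * θ := by nlinarith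
  exact norm_iter_plaqHol_sub_one_sub_linProxy_le_of_box_of_budgets U hn hnN hθ hU c hc z₀ hz hlo hhi hθΘ hηΘ hM1 (by positivity)
    (by positivity) (fun x hx0 hx1 => budget_step_a P.d P.L hx0 hx1) (fun x hx0 => budget_step_eta P.d P.L hx0 le_rfl hx0 le_rfl)
    (fun x r hx0 hx1 hr => budget_step_rho P.d P.L hx0 hx1 hr) hwin hwinδ μ ν hμν

/-! ## §4 A box for every plaquette -/

/-- ★★ **A BOX FOR EVERY BLOCK PLAQUETTE.**  For every level-`j` plaquette `a` of a torus with room (`2R₀ + 2 < sitesPerDir 0`,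
`R₀ = ((d+4)L+2)·Σ_{k<j} L^k ≤ ((d+4)L+2)·L^j`) there is a non-wrapping integer box `[lo, hi]` of side `n₀ = 2R₀ + 2 ≤ (2(d+4)L+6)·L^j` around the
iterated block centre of `a` such that for EVERY level-0 field `U` and EVERY `θ ≥ 0` in the window (`Θ = (1+(d−1)n₀)θ`, `M^jΘ ≤ 1`,
`(((d+4)L)²∕4)·M^jΘ ≤ δ_N∕2`), on `PlaqSmallOn (boxPlaqs lo hi) θ U` the axial-gauge representative `V = U^{axialGauge U lo hi}` satisfies
`‖(V̄^{j}(∂a) : M_N) − 1 − Σ_p linWeight j a p • ((V(∂p) : M_N) − 1)‖ ≤ C₁·(M² + C₂)^j·Θ²` (constants of §3).  This is the `∃ (lo hi n)` shape of LINE 28's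
`stub_linTest`, deterministic half. [cite: Balaban1985Averaging, Prop. 1 (51) pp.25-26; Balaban1987RG1, (0.1)-(0.4) and (0.11) pp.251-253; Balaban1985UV3, (38)-(40) p.266] -/
theorem exists_box_linearisation (j : ℕ) (a : Plaq P j)
    (hroom : 2 * (((P.d + 4) * P.L + 2) * ∑ k ∈ Finset.range j, P.L ^ k) + 2 < P.sitesPerDir 0) :
    ∃ (lo hi : Fin P.d → ℤ) (n₀ : ℕ), (∀ κ, lo κ ≤ hi κ ∧ hi κ ≤ lo κ + n₀) ∧ n₀ < P.sitesPerDir 0 ∧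
      n₀ ≤ (2 * ((P.d + 4) * P.L + 2) + 2) * P.L ^ j ∧
      ∀ (U : GaugeField P 0 (Matrix.specialUnitaryGroup n ℂ)) (θ : ℝ), 0 ≤ θ → PlaqSmallOn (boxPlaqs lo hi) θ U →
        ((P.L : ℝ) ^ 2 + 143 * ((((P.d + 4) * P.L : ℕ) : ℝ) ^ 2 / 4) ^ 2 + 6 * ((((P.d + 2) * P.L : ℕ) : ℝ) ^ 2 / 4) + P.L) ^ j *
            ((1 + ((P.d - 1 : ℕ) : ℝ) * n₀) * θ) ≤ 1 →
        ((((P.d + 4) * P.L : ℕ) : ℝ) ^ 2 / 4) *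
            (((P.L : ℝ) ^ 2 + 143 * ((((P.d + 4) * P.L : ℕ) : ℝ) ^ 2 / 4) ^ 2 + 6 * ((((P.d + 2) * P.L : ℕ) : ℝ) ^ 2 / 4) + P.L) ^ j *
              ((1 + ((P.d - 1 : ℕ) : ℝ) * n₀) * θ)) ≤ deltaSU n / 2 →
        ‖(((GaugeField.plaqHol (Averaging.iter (fun i' => blockAvg (P := P) (j := i') (expMeanLogSU (n := n))) j
                (GaugeField.gaugeAct (axialGauge U lo hi) U)) a : Matrix.specialUnitaryGroup n ℂ) : Matrix n n ℂ) - 1) -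
            ∑ p : Plaq P 0, ((linWeight j a p : ℝ) : ℂ) •
              ((((GaugeField.plaqHol (GaugeField.gaugeAct (axialGauge U lo hi) U) p : Matrix.specialUnitaryGroup n ℂ)) : Matrix n n ℂ) - 1)‖ ≤
          (143 * ((((P.d + 4) * P.L : ℕ) : ℝ) ^ 2 / 4) ^ 2 + (P.L : ℝ) ^ 4 + 2 * (((P.d + 4) * P.L : ℕ) : ℝ) * (P.L : ℝ) ^ 2) *
            (((P.L : ℝ) ^ 2 + 143 * ((((P.d + 4) * P.L : ℕ) : ℝ) ^ 2 / 4) ^ 2 + 6 * ((((P.d + 2) * P.L : ℕ) : ℝ) ^ 2 / 4) + P.L) ^ 2 +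
                ((P.L : ℝ) ^ 2 + 2 * (((P.d + 4) * P.L : ℕ) : ℝ) * (P.L : ℝ) ^ 2)) ^ j *
              ((1 + ((P.d - 1 : ℕ) : ℝ) * n₀) * θ) ^ 2 := by
  obtain ⟨src, μ, ν, hμν⟩ := a
  obtain ⟨c, hcj, hc⟩ := exists_cone (P := P) j src
  obtain ⟨z₀, lo, hi, hz, hbox, hlo, hhi⟩ := exists_box_around (c 0) (((P.d + 4) * P.L + 2) * ∑ k ∈ Finset.range j, P.L ^ k)
  refine ⟨lo, hi, 2 * (((P.d + 4) * P.L + 2) * ∑ k ∈ Finset.range j, P.L ^ k) + 2, hbox, hroom, ?_, fun U θ hθ hU hwin hwinδ => ?_⟩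
  · have h1 := sum_pow_lt_le (P := P) j
    have h2 : 2 * 1 ≤ 2 * P.L ^ j := Nat.mul_le_mul_left 2 (Nat.one_le_pow _ _ P.L_pos)
    have h3 : 2 * (((P.d + 4) * P.L + 2) * ∑ k ∈ Finset.range j, P.L ^ k) ≤ 2 * (((P.d + 4) * P.L + 2) * P.L ^ j) :=
      Nat.mul_le_mul_left 2 (Nat.mul_le_mul_left _ h1)
    calc 2 * (((P.d + 4) * P.L + 2) * ∑ k ∈ Finset.range j, P.L ^ k) + 2
        ≤ 2 * (((P.d + 4) * P.L + 2) * P.L ^ j) + 2 * P.L ^ j := Nat.add_le_add h3 (by simpa using h2)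
      _ = (2 * ((P.d + 4) * P.L + 2) + 2) * P.L ^ j := by ring
  · rw [← hcj]
    exact norm_iter_plaqHol_sub_one_sub_linProxy_le_of_plaqSmallOn_box U (fun κ => (hbox κ).2) hroom hθ hU c hc z₀ hz hlo hhi
      hwin hwinδ μ ν hμν

end Main

end Summit.QuantumFields.YangMills.Theorems.UnitScaleGibbsBlockPlaquetteLinearisationOnBoxEvent

end
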